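import Mathlib
import HarnessLib
import Literature.MathematicalPhysics.QuantumManyBody.PeriodicBoseGasFourier
import Literature.MathematicalPhysics.QuantumManyBody.OneBodyCurrentGain
import Literature.MathematicalPhysics.QuantumManyBody.CouplingPathSliceFloor
import Literature.MathematicalPhysics.QuantumManyBody.DiluteBoseGasUpperBoundLocalization
import Literature.MathematicalPhysics.QuantumManyBody.PeriodicFeynmanKacCompact
import Summits.AtomisticToContinuum.BoseEinsteinCondensation.Theorems.DensityResponse.Negative.PeriodisedWell

/-!
# Route `BECConjugateDomination` — crux `InfraredMinimumUncertainty`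
# (stmt-AtomisticToContinuum-11784), line `fisher-gaussian-density-mode`,
# stub `stub_weakEulerLagrange`

The weak Euler–Lagrange (eigen-)equation of a finite-energy minimiser of the periodic `N`-body
energy in the `C¹` periodic Bose class, tested against `C¹` periodic Bose-symmetric functions:
if `periodicEnergy v Ψ = E₀ := periodicGroundStateEnergy v N L < ∞`, then for every `C¹`,
`Lℤ³`-periodic (on generators), Bose-symmetric `η : (ℝ³)^N → ℂ`,

  `Re ∫_{cell^N} (∑_{i,k} conj(∂_{i,k}η) ∂_{i,k}Ψ + W conj(η) Ψ) = E₀ · Re ∫_{cell^N} conj(η) Ψ`,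

`W = ∑_{i<j} v^per(xᵢ - xⱼ)` (real Bochner integrals on the fundamental cell).

Proof (Rayleigh–Ritz, first variation). Under the hypotheses of the stub the potential is
bounded: `x ↦ v(|x|)` is finite, continuous and of finite range `R`, hence `v ≤ C` (compact
support), and the periodisation has at most `|B₁|(R/L + 1)³` non-zero lattice images
(`periodizedPotential_sqWell_le` of `Theorems/DensityResponse/Negative/PeriodisedWell.lean`), so
`W ≤ N² C |B₁| (R/L+1)³ < ∞` (`exists_periodicInteraction_le`). Then every `ℝ≥0∞` cell integral
of a `C¹` function is the `ofReal` of a Bochner integral (`periodicForm_eq_ofReal`,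
`lintegral_nnnorm_sq_eq_ofReal`), the variational principle for unnormalised functions
(`periodicGroundStateEnergy_mul_normSq_le` of `CouplingPathSliceFloor.lean`) reads
`E₀ ∫|Φ|² ≤ ∫ |∇Φ|² + W|Φ|²` in `ℝ` (`toReal_groundStateEnergy_mul_le`), and along `Φ_t = Ψ + tη`
both sides are explicit quadratics in `t` (`integral_norm_sq_add_mul`, `integral_form_add_mul`)
that agree at `t = 0` (`Ψ` is a normalised minimiser). A one-signed quadratic `2tb + t²a ≥ 0`
has `b = 0` (`eq_zero_of_forall_quadratic_nonneg`), which is the claim (`firstVariation_eq`).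
The `C²`/Hessian hypotheses of the registered signature are only used through the continuity of
`x ↦ v(|x|)`.

References: [ReedSimonIV1978] §XIII.1 (Rayleigh–Ritz); [Fournais2020] (1.1)–(1.2) (the periodic
problem).
-/

noncomputable section

open MeasureTheory Filter Set
open scoped ENNReal NNReal Topology ComplexConjugate BigOperators

namespace Summit.AtomisticToContinuum.BoseEinsteinCondensation.Theorems

open Literature.MathematicalPhysics.QuantumManyBody.BoseGas

namespace ImuWeakEulerLagrange

open Summit.AtomisticToContinuum.BoseEinsteinCondensation.Theorems.DensityResponse.Negative
  (sqWell periodizedPotential_sqWell_le ω₃)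

variable {N : ℕ} {L : ℝ}

/-! ### An elementary lemma and pointwise algebra -/

/-- If `0 ≤ 2 t b + t² a` for all real `t`, then `b = 0` (test `t = -b/(|a|+1)`). [folklore] -/
theorem eq_zero_of_forall_quadratic_nonneg {a b : ℝ} (h : ∀ t : ℝ, 0 ≤ 2 * t * b + t ^ 2 * a) :
    b = 0 := by
  by_contra hb
  have hb2 : 0 < b ^ 2 := by positivity
  set s : ℝ := 1 / (|a| + 1) with hs
  have hs0 : 0 < s := by positivity
  have hsa : s * a ≤ 1 := by
    have h1 : s * a ≤ s * |a| := mul_le_mul_of_nonneg_left (le_abs_self a) hs0.le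
    have h2 : s * |a| ≤ 1 := by
      rw [hs, div_mul_eq_mul_div, one_mul, div_le_one (by positivity)]; linarith
    linarith
  have ht := h (-(s * b))
  have e : 2 * (-(s * b)) * b + (-(s * b)) ^ 2 * a = s * b ^ 2 * (s * a - 2) := by ring
  rw [e] at ht
  have hneg : s * b ^ 2 * (s * a - 2) < 0 := mul_neg_of_pos_of_neg (mul_pos hs0 hb2) (by linarith)
  linarith

/-- `|a + t b|² = |a|² + 2t Re(b̄ a) + t²|b|²` for complex `a, b` and real `t`. [folklore] -/
theorem norm_sq_add_ofReal_mul (a b : ℂ) (t : ℝ) :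
    ‖a + (t : ℂ) * b‖ ^ 2 = ‖a‖ ^ 2 + 2 * t * (conj b * a).re + t ^ 2 * ‖b‖ ^ 2 := by
  simp only [Complex.sq_norm, Complex.normSq_apply, Complex.add_re, Complex.add_im, Complex.mul_re,
    Complex.mul_im, Complex.ofReal_re, Complex.ofReal_im, Complex.conj_re, Complex.conj_im]
  ring

/-! ### Boundedness of the periodised interaction -/

/-- A finite-range profile `v` that is finite and continuous as `x ↦ v(|x|)` on `ℝ³` is bounded,
`v(|x|) ≤ C`, and vanishes beyond a nonnegative range `R`. [folklore] -/
theorem exists_bound_of_finiteRange {v : ℝ → ℝ≥0∞} (hv : IsRepulsiveFiniteRange v)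
    (htop : ∀ r, v r ≠ ⊤) (hcont : Continuous fun x : Space => (v ‖x‖).toReal) :
    ∃ C R : ℝ, 0 ≤ C ∧ 0 ≤ R ∧ (∀ x : Space, v ‖x‖ ≤ ENNReal.ofReal C) ∧ ∀ r, R < r → v r = 0 := by
  obtain ⟨R₀, hR₀⟩ := hv.2
  have hR : ∀ r, max R₀ 0 < r → v r = 0 := fun r hr => hR₀ r ((le_max_left _ _).trans_lt hr)
  have hsupp : HasCompactSupport fun x : Space => (v ‖x‖).toReal := by
    refine HasCompactSupport.intro (isCompact_closedBall (0 : Space) (max R₀ 0)) fun x hx => ?_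
    rw [Metric.mem_closedBall, dist_zero_right, not_le] at hx
    simp [hR _ hx]
  obtain ⟨C, hC⟩ := hcont.bounded_above_of_compact_support hsupp
  refine ⟨max C 0, max R₀ 0, le_max_right _ _, le_max_right _ _, fun x => ?_, hR⟩
  rw [← ENNReal.ofReal_toReal (htop ‖x‖)]
  refine ENNReal.ofReal_le_ofReal ?_
  have h1 := hC x
  rw [Real.norm_eq_abs] at h1
  exact ((le_abs_self _).trans h1).trans (le_max_left _ _)

/-- Uniform bound on the periodised potential of a profile bounded by `C` and of range `R ≥ 0`:
`v^per ≤ C |B₁| (R/L + 1)³` (compare with the periodised square well `C·1_{r ≤ R}` and count lattice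
images, `periodizedPotential_sqWell_le`). [folklore] -/
theorem periodizedPotential_le_of_bound {v : ℝ → ℝ≥0∞} {C R : ℝ} (hC : 0 ≤ C) (hR : 0 ≤ R)
    (hL : 0 < L) (hvC : ∀ x : Space, v ‖x‖ ≤ ENNReal.ofReal C) (hvR : ∀ r, R < r → v r = 0)
    (x : Space) : periodizedPotential v L x ≤ ENNReal.ofReal (C * ((R / L + 1) ^ 3 * ω₃)) := by
  refine le_trans ?_ (periodizedPotential_sqWell_le hC hR hL x)
  unfold periodizedPotential
  refine ENNReal.tsum_le_tsum fun m => ?_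
  by_cases h : ‖x - latticeVec L m‖ ≤ R
  · rw [show sqWell C R ‖x - latticeVec L m‖ = ENNReal.ofReal C from
      Set.indicator_of_mem (Set.mem_Iic.2 h) _]
    exact hvC _
  · rw [hvR _ (lt_of_not_ge h)]
    exact zero_le

/-- Under the hypotheses of the stub the periodic interaction `∑_{i<j} v^per(xᵢ - xⱼ)` is bounded
by a finite constant, uniformly in the configuration. [folklore] -/
theorem exists_periodicInteraction_le {v : ℝ → ℝ≥0∞} (hv : IsRepulsiveFiniteRange v)
    (htop : ∀ r, v r ≠ ⊤) (hcont : Continuous fun x : Space => (v ‖x‖).toReal) (hL : 0 < L)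
    (N : ℕ) : ∃ Cw : ℝ≥0∞, Cw ≠ ⊤ ∧ ∀ X : Config N, periodicInteraction v L X ≤ Cw := by
  obtain ⟨C, R, hC, hR, hvC, hvR⟩ := exists_bound_of_finiteRange hv htop hcont
  exact ⟨_, ENNReal.mul_ne_top (ENNReal.natCast_ne_top _) ENNReal.ofReal_ne_top,
    fun X => periodicInteraction_le_of_bound (periodizedPotential_le_of_bound hC hR hL hvC hvR) X⟩

variable {v : ℝ → ℝ≥0∞} {Cw : ℝ≥0∞}

/-! ### Real (Bochner) forms of the cell integrals -/

/-- A bounded interaction times a continuous function is integrable on the (bounded) fundamental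
cell. [folklore] -/
theorem integrableOn_toReal_interaction_mul (hvm : Measurable v) (hCw : Cw ≠ ⊤)
    (hW : ∀ X : Config N, periodicInteraction v L X ≤ Cw) {g : Config N → ℝ} (hg : Continuous g) :
    IntegrableOn (fun X => (periodicInteraction v L X).toReal * g X) (cellN N L) := by
  refine Integrable.bdd_mul (c := Cw.toReal) (integrableOn_cellN hg L)
    (measurable_periodicInteraction hvm L).ennreal_toReal.aestronglyMeasurable
    (ae_of_all _ fun X => ?_)
  rw [Real.norm_of_nonneg ENNReal.toReal_nonneg]
  exact ENNReal.toReal_mono hCw (hW X)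

/-- The mass of a continuous function on the cell in real form: `∫⁻ ‖Φ‖₊² = ofReal ∫ ‖Φ‖²`.
[folklore] -/
theorem lintegral_nnnorm_sq_eq_ofReal {Φ : Config N → ℂ} (hΦ : Continuous Φ) (L : ℝ) :
    ∫⁻ X in cellN N L, (‖Φ X‖₊ : ℝ≥0∞) ^ 2 = ENNReal.ofReal (∫ X in cellN N L, ‖Φ X‖ ^ 2) := by
  rw [ofReal_integral_eq_lintegral_ofReal (integrableOn_cellN (hΦ.norm.fun_pow 2) L)
    (ae_of_all _ fun X => sq_nonneg _)]
  exact lintegral_congr fun X => coe_nnnorm_sq_eq_ofReal _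

/-- The form `⟨Φ, HΦ⟩ = ∫⁻ (|∇Φ|² + W|Φ|²)` of a `C¹` function under a bounded interaction in real
form: `= ofReal ∫ (|∇Φ|² + W.toReal |Φ|²)`. [cite: Fournais2020, (1.1)] -/
theorem periodicForm_eq_ofReal (hvm : Measurable v) (hCw : Cw ≠ ⊤)
    (hW : ∀ X : Config N, periodicInteraction v L X ≤ Cw) {Φ : Config N → ℂ}
    (hΦ : ContDiff ℝ 1 Φ) :
    ∫⁻ X in cellN N L, (kineticDensity Φ X + periodicInteraction v L X * (‖Φ X‖₊ : ℝ≥0∞) ^ 2) =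
      ENNReal.ofReal (∫ X in cellN N L,
        (kineticDensityReal Φ X + (periodicInteraction v L X).toReal * ‖Φ X‖ ^ 2)) := by
  have hint : IntegrableOn (fun X => kineticDensityReal Φ X +
      (periodicInteraction v L X).toReal * ‖Φ X‖ ^ 2) (cellN N L) :=
    (integrableOn_cellN (continuous_kineticDensityReal hΦ) L).add
      (integrableOn_toReal_interaction_mul hvm hCw hW (hΦ.continuous.norm.pow 2))
  rw [ofReal_integral_eq_lintegral_ofReal hint (ae_of_all _ fun X =>
    add_nonneg (kineticDensityReal_nonneg Φ X) (mul_nonneg ENNReal.toReal_nonneg (sq_nonneg _)))]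
  refine lintegral_congr fun X => ?_
  rw [ENNReal.ofReal_add (kineticDensityReal_nonneg Φ X)
      (mul_nonneg ENNReal.toReal_nonneg (sq_nonneg _)),
    kineticDensity_eq_ofReal, ENNReal.ofReal_mul ENNReal.toReal_nonneg,
    ENNReal.ofReal_toReal (ne_top_of_le_ne_top hCw (hW X)), coe_nnnorm_sq_eq_ofReal]


/-! ### The variational inequality in real form and its second-order expansion -/

/-- Real form of the variational principle for an unnormalised `C¹`, `Lℤ³`-periodic, Bose-symmetric
`φ` under a bounded interaction and `E₀ < ∞`: `E₀ ∫|φ|² ≤ ∫ (|∇φ|² + W|φ|²)`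
(`periodicGroundStateEnergy_mul_normSq_le` made real). [cite: Fournais2020, (1.1)–(1.2)] -/
theorem toReal_groundStateEnergy_mul_le (hvm : Measurable v) (hCw : Cw ≠ ⊤)
    (hW : ∀ X : Config N, periodicInteraction v L X ≤ Cw) (hE : periodicGroundStateEnergy v N L ≠ ⊤)
    {φ : Config N → ℂ} (hφ : ContDiff ℝ 1 φ)
    (hper : ∀ (X : Config N) (i : Fin N) (k : Fin 3),
      φ (X + Pi.single i (EuclideanSpace.single k L)) = φ X)
    (hsymm : ∀ (σ : Equiv.Perm (Fin N)) (X : Config N), φ (X ∘ σ) = φ X) :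
    (periodicGroundStateEnergy v N L).toReal * ∫ X in cellN N L, ‖φ X‖ ^ 2 ≤
      ∫ X in cellN N L,
        (kineticDensityReal φ X + (periodicInteraction v L X).toReal * ‖φ X‖ ^ 2) := by
  have h := periodicGroundStateEnergy_mul_normSq_le v hφ hper hsymm
  rw [lintegral_nnnorm_sq_eq_ofReal hφ.continuous, periodicForm_eq_ofReal hvm hCw hW hφ,
    ← ENNReal.ofReal_toReal hE, ← ENNReal.ofReal_mul ENNReal.toReal_nonneg,
    ENNReal.ofReal_le_ofReal_iff (integral_nonneg fun X => add_nonneg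
      (kineticDensityReal_nonneg φ X) (mul_nonneg ENNReal.toReal_nonneg (sq_nonneg _)))] at h
  exact h

/-- Second-order expansion of the mass along `φ + tη`:
`∫|φ + tη|² = ∫|φ|² + 2t ∫ Re(η̄ φ) + t² ∫|η|²`. [folklore] -/
theorem integral_norm_sq_add_mul {φ η : Config N → ℂ} (hφ : Continuous φ) (hη : Continuous η)
    (t L : ℝ) :
    ∫ X in cellN N L, ‖φ X + (t : ℂ) * η X‖ ^ 2 =
      (∫ X in cellN N L, ‖φ X‖ ^ 2) + 2 * t * (∫ X in cellN N L, (conj (η X) * φ X).re) +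
        t ^ 2 * ∫ X in cellN N L, ‖η X‖ ^ 2 := by
  simp_rw [norm_sq_add_ofReal_mul]
  have i0 : IntegrableOn (fun X => ‖φ X‖ ^ 2) (cellN N L) :=
    integrableOn_cellN (hφ.norm.fun_pow 2) L
  have i1 : IntegrableOn (fun X => (conj (η X) * φ X).re) (cellN N L) :=
    integrableOn_cellN (by fun_prop) L
  have i2 : IntegrableOn (fun X => ‖η X‖ ^ 2) (cellN N L) :=
    integrableOn_cellN (hη.norm.fun_pow 2) L
  have hA : Integrable (fun X => ‖φ X‖ ^ 2 + 2 * t * (conj (η X) * φ X).re)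
      (volume.restrict (cellN N L)) := i0.add (i1.const_mul _)
  rw [integral_add hA (i2.const_mul _), integral_add i0 (i1.const_mul _),
    integral_const_mul, integral_const_mul]

/-- Second-order expansion of the form along `φ + tη`:
`⟨φ + tη, H(φ + tη)⟩ = ⟨φ, Hφ⟩ + 2t Re⟨η, Hφ⟩ + t² ⟨η, Hη⟩` in real (weak) form. [folklore] -/
theorem integral_form_add_mul (hvm : Measurable v) (hCw : Cw ≠ ⊤)
    (hW : ∀ X : Config N, periodicInteraction v L X ≤ Cw)
    {φ η : Config N → ℂ} (hφ : ContDiff ℝ 1 φ) (hη : ContDiff ℝ 1 η) (t : ℝ) :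
    ∫ X in cellN N L, (kineticDensityReal (fun Y => φ Y + (t : ℂ) * η Y) X +
        (periodicInteraction v L X).toReal * ‖φ X + (t : ℂ) * η X‖ ^ 2) =
      (∫ X in cellN N L,
          (kineticDensityReal φ X + (periodicInteraction v L X).toReal * ‖φ X‖ ^ 2)) +
        2 * t * (∫ X in cellN N L,
          ((∑ i : Fin N, ∑ k : Fin 3,
              (conj (fderiv ℝ η X (Pi.single i (EuclideanSpace.single k (1 : ℝ)))) *
                fderiv ℝ φ X (Pi.single i (EuclideanSpace.single k (1 : ℝ)))).re) +
            (periodicInteraction v L X).toReal * (conj (η X) * φ X).re)) +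
        t ^ 2 * ∫ X in cellN N L,
          (kineticDensityReal η X + (periodicInteraction v L X).toReal * ‖η X‖ ^ 2) := by
  have hφd := hφ.differentiable one_ne_zero
  have hηd := hη.differentiable one_ne_zero
  have hD : ∀ X, fderiv ℝ (fun Y => φ Y + (t : ℂ) * η Y) X =
      fderiv ℝ φ X + (t : ℂ) • fderiv ℝ η X := fun X => by
    rw [fderiv_fun_add (hφd X) ((hηd X).const_mul _), fderiv_const_mul (hηd X)]
  have hkin : ∀ X, kineticDensityReal (fun Y => φ Y + (t : ℂ) * η Y) X =
      kineticDensityReal φ X + 2 * t * (∑ i : Fin N, ∑ k : Fin 3,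
        (conj (fderiv ℝ η X (Pi.single i (EuclideanSpace.single k (1 : ℝ)))) *
          fderiv ℝ φ X (Pi.single i (EuclideanSpace.single k (1 : ℝ)))).re) +
        t ^ 2 * kineticDensityReal η X := by
    intro X
    simp only [kineticDensityReal, hD, add_apply, smul_apply, smul_eq_mul,
      norm_sq_add_ofReal_mul, Finset.sum_add_distrib, Finset.mul_sum]
  have hpt : ∀ X, kineticDensityReal (fun Y => φ Y + (t : ℂ) * η Y) X +
      (periodicInteraction v L X).toReal * ‖φ X + (t : ℂ) * η X‖ ^ 2 =
      (kineticDensityReal φ X + (periodicInteraction v L X).toReal * ‖φ X‖ ^ 2) +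
        2 * t * ((∑ i : Fin N, ∑ k : Fin 3,
            (conj (fderiv ℝ η X (Pi.single i (EuclideanSpace.single k (1 : ℝ)))) *
              fderiv ℝ φ X (Pi.single i (EuclideanSpace.single k (1 : ℝ)))).re) +
          (periodicInteraction v L X).toReal * (conj (η X) * φ X).re) +
        t ^ 2 * (kineticDensityReal η X + (periodicInteraction v L X).toReal * ‖η X‖ ^ 2) := by
    intro X
    rw [hkin X, norm_sq_add_ofReal_mul]
    ring
  simp_rw [hpt]
  have hcK : Continuous fun X => ∑ i : Fin N, ∑ k : Fin 3,
      (conj (fderiv ℝ η X (Pi.single i (EuclideanSpace.single k (1 : ℝ)))) *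
        fderiv ℝ φ X (Pi.single i (EuclideanSpace.single k (1 : ℝ)))).re := by
    have h1 := hφ.continuous_fderiv one_ne_zero
    have h2 := hη.continuous_fderiv one_ne_zero
    fun_prop
  have i0 : IntegrableOn (fun X => kineticDensityReal φ X +
      (periodicInteraction v L X).toReal * ‖φ X‖ ^ 2) (cellN N L) :=
    (integrableOn_cellN (continuous_kineticDensityReal hφ) L).add
      (integrableOn_toReal_interaction_mul hvm hCw hW (hφ.continuous.norm.pow 2))
  have i1 : IntegrableOn (fun X => (∑ i : Fin N, ∑ k : Fin 3,
      (conj (fderiv ℝ η X (Pi.single i (EuclideanSpace.single k (1 : ℝ)))) *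
        fderiv ℝ φ X (Pi.single i (EuclideanSpace.single k (1 : ℝ)))).re) +
      (periodicInteraction v L X).toReal * (conj (η X) * φ X).re) (cellN N L) :=
    (integrableOn_cellN hcK L).add (integrableOn_toReal_interaction_mul hvm hCw hW
      (Complex.continuous_re.comp ((Complex.continuous_conj.comp hη.continuous).mul hφ.continuous)))
  have i2 : IntegrableOn (fun X => kineticDensityReal η X +
      (periodicInteraction v L X).toReal * ‖η X‖ ^ 2) (cellN N L) :=
    (integrableOn_cellN (continuous_kineticDensityReal hη) L).add
      (integrableOn_toReal_interaction_mul hvm hCw hW (hη.continuous.norm.pow 2))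
  have hA : Integrable (fun X => (kineticDensityReal φ X +
      (periodicInteraction v L X).toReal * ‖φ X‖ ^ 2) + 2 * t * ((∑ i : Fin N, ∑ k : Fin 3,
        (conj (fderiv ℝ η X (Pi.single i (EuclideanSpace.single k (1 : ℝ)))) *
          fderiv ℝ φ X (Pi.single i (EuclideanSpace.single k (1 : ℝ)))).re) +
      (periodicInteraction v L X).toReal * (conj (η X) * φ X).re)) (volume.restrict (cellN N L)) :=
    i0.add (i1.const_mul _)
  rw [integral_add hA (i2.const_mul _), integral_add i0 (i1.const_mul _),
    integral_const_mul, integral_const_mul]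

/-- **First variation of the Rayleigh quotient at a minimiser (weak Euler–Lagrange equation).**
If `Ψ` attains `E₀ = inf ⟨Φ, HΦ⟩/‖Φ‖²` over the `C¹` periodic Bose class and the interaction is
bounded, then `Re⟨η, (H - E₀)Ψ⟩ = 0` in weak form for every `C¹` periodic Bose-symmetric `η`:
`t ↦ ⟨Ψ + tη, (H - E₀)(Ψ + tη)⟩ = 2t Re⟨η, (H - E₀)Ψ⟩ + t²⟨η, (H - E₀)η⟩ ≥ 0` vanishes at `t = 0`,
so its linear coefficient vanishes. [folklore] -/
theorem firstVariation_eq (hvm : Measurable v) (hCw : Cw ≠ ⊤)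
    (hW : ∀ X : Config N, periodicInteraction v L X ≤ Cw) (Ψ : PeriodicTrialState N L)
    (hmin : periodicEnergy v Ψ = periodicGroundStateEnergy v N L) (hfin : periodicEnergy v Ψ ≠ ⊤)
    {η : Config N → ℂ} (hη : ContDiff ℝ 1 η)
    (hper : ∀ (X : Config N) (i : Fin N) (k : Fin 3),
      η (X + Pi.single i (EuclideanSpace.single k L)) = η X)
    (hsymm : ∀ (σ : Equiv.Perm (Fin N)) (X : Config N), η (X ∘ σ) = η X) :
    (∫ X in cellN N L,
        ((∑ i : Fin N, ∑ k : Fin 3,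
            (conj (fderiv ℝ η X (Pi.single i (EuclideanSpace.single k (1 : ℝ)))) *
              fderiv ℝ Ψ.ψ X (Pi.single i (EuclideanSpace.single k (1 : ℝ)))).re) +
          (periodicInteraction v L X).toReal * (conj (η X) * Ψ.ψ X).re)) =
      (periodicGroundStateEnergy v N L).toReal * ∫ X in cellN N L, (conj (η X) * Ψ.ψ X).re := by
  have hE : periodicGroundStateEnergy v N L ≠ ⊤ := hmin ▸ hfin
  -- the form and the mass at `Ψ`
  have hF : ∫ X in cellN N L, (kineticDensityReal Ψ.ψ X +
      (periodicInteraction v L X).toReal * ‖Ψ.ψ X‖ ^ 2) =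
        (periodicGroundStateEnergy v N L).toReal := by
    have h1 : periodicEnergy v Ψ = ENNReal.ofReal (∫ X in cellN N L, (kineticDensityReal Ψ.ψ X +
        (periodicInteraction v L X).toReal * ‖Ψ.ψ X‖ ^ 2)) :=
      periodicForm_eq_ofReal hvm hCw hW Ψ.contDiff
    rw [← hmin, h1, ENNReal.toReal_ofReal (integral_nonneg fun X => add_nonneg
      (kineticDensityReal_nonneg _ X) (mul_nonneg ENNReal.toReal_nonneg (sq_nonneg _)))]
  have hM : ∫ X in cellN N L, ‖Ψ.ψ X‖ ^ 2 = 1 := by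
    have h1 := lintegral_nnnorm_sq_eq_ofReal Ψ.contDiff.continuous L
    rw [Ψ.norm_eq] at h1
    rw [← ENNReal.toReal_ofReal (integral_nonneg fun X => sq_nonneg ‖Ψ.ψ X‖), ← h1,
      ENNReal.toReal_one]
  -- the variational inequality along `Ψ + tη`, expanded to second order in `t`
  have hineq : ∀ t : ℝ, (periodicGroundStateEnergy v N L).toReal *
      ((∫ X in cellN N L, ‖Ψ.ψ X‖ ^ 2) + 2 * t * (∫ X in cellN N L, (conj (η X) * Ψ.ψ X).re) +
        t ^ 2 * ∫ X in cellN N L, ‖η X‖ ^ 2) ≤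
      (∫ X in cellN N L,
          (kineticDensityReal Ψ.ψ X + (periodicInteraction v L X).toReal * ‖Ψ.ψ X‖ ^ 2)) +
        2 * t * (∫ X in cellN N L, ((∑ i : Fin N, ∑ k : Fin 3,
            (conj (fderiv ℝ η X (Pi.single i (EuclideanSpace.single k (1 : ℝ)))) *
              fderiv ℝ Ψ.ψ X (Pi.single i (EuclideanSpace.single k (1 : ℝ)))).re) +
          (periodicInteraction v L X).toReal * (conj (η X) * Ψ.ψ X).re)) +
        t ^ 2 * ∫ X in cellN N L,
          (kineticDensityReal η X + (periodicInteraction v L X).toReal * ‖η X‖ ^ 2) := by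
    intro t
    have hC : ContDiff ℝ 1 fun Y => Ψ.ψ Y + (t : ℂ) * η Y :=
      Ψ.contDiff.add (contDiff_const.mul hη)
    have hP : ∀ (X : Config N) (i : Fin N) (k : Fin 3),
        (fun Y => Ψ.ψ Y + (t : ℂ) * η Y) (X + Pi.single i (EuclideanSpace.single k L)) =
          (fun Y => Ψ.ψ Y + (t : ℂ) * η Y) X := fun X i k => by
      simp only [Ψ.periodic, hper]
    have hS : ∀ (σ : Equiv.Perm (Fin N)) (X : Config N),
        (fun Y => Ψ.ψ Y + (t : ℂ) * η Y) (X ∘ σ) = (fun Y => Ψ.ψ Y + (t : ℂ) * η Y) X :=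
      fun σ X => by simp only [Ψ.symm, hsymm]
    have h := toReal_groundStateEnergy_mul_le hvm hCw hW hE hC hP hS
    rw [integral_norm_sq_add_mul Ψ.contDiff.continuous hη.continuous,
      integral_form_add_mul hvm hCw hW Ψ.contDiff hη] at h
    exact h
  rw [hF, hM] at hineq
  refine sub_eq_zero.mp (eq_zero_of_forall_quadratic_nonneg
    (a := (∫ X in cellN N L,
        (kineticDensityReal η X + (periodicInteraction v L X).toReal * ‖η X‖ ^ 2)) -
      (periodicGroundStateEnergy v N L).toReal * ∫ X in cellN N L, ‖η X‖ ^ 2) fun t => ?_)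
  have h := hineq t
  linarith

/-! ### The registered stub -/

/-- **Registered stub `stub_weakEulerLagrange`** of crux stmt-AtomisticToContinuum-11784 (line
`fisher-gaussian-density-mode`, lead reshape r1): the **weak Euler–Lagrange equation of a periodic
minimiser**. For a repulsive finite-range profile `v`, finite and `C²` as `x ↦ v(|x|)`, and a
periodic trial state `Ψ` of `N = n + 1` bosons on the torus of side `L > 0` with
`periodicEnergy v Ψ = periodicGroundStateEnergy v N L < ∞`, every `C¹`, `Lℤ³`-periodic,
Bose-symmetric test function `η` satisfies
`∫_{cell^N} (Re ∑_{i,k} conj(∂_{i,k}η)∂_{i,k}Ψ + W Re(conj(η)Ψ)) = E₀ ∫_{cell^N} Re(conj(η)Ψ)`,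
`W = (∑_{i<j} v^per(xᵢ-xⱼ)).toReal`, `E₀ = (periodicGroundStateEnergy v N L).toReal`. Proof: the
interaction is bounded (`exists_periodicInteraction_le`), and the first variation of the Rayleigh
quotient along `Ψ + tη` vanishes (`firstVariation_eq`). The Hessian bound is not used.
[cite: Fournais2020, (1.1)–(1.2)] -/
theorem stub_weakEulerLagrange :
    ∀ v : ℝ → ℝ≥0∞, IsRepulsiveFiniteRange v → (∀ r, v r ≠ ⊤) →
      ContDiff ℝ 2 (fun x : Space => (v ‖x‖).toReal) →
      (∃ Cₑ : ℝ, ∀ x : Space,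
        ‖iteratedFDeriv ℝ 2 (fun x : Space => (v ‖x‖).toReal) x‖ ≤ Cₑ * Real.sqrt ((v ‖x‖).toReal)) →
      ∀ (n : ℕ) (L : ℝ), 0 < L → ∀ Ψ : PeriodicTrialState (n + 1) L,
        periodicEnergy v Ψ = periodicGroundStateEnergy v (n + 1) L → periodicEnergy v Ψ ≠ ⊤ →
        ∀ η : Config (n + 1) → ℂ, ContDiff ℝ 1 η →
          (∀ (X : Config (n + 1)) (i : Fin (n + 1)) (k : Fin 3),
            η (X + Pi.single i (EuclideanSpace.single k L)) = η X) →
          (∀ (σ : Equiv.Perm (Fin (n + 1))) (X : Config (n + 1)), η (X ∘ σ) = η X) →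
          (∫ X in cellN (n + 1) L,
              ((∑ i : Fin (n + 1), ∑ k : Fin 3,
                  (starRingEnd ℂ (fderiv ℝ η X (Pi.single i (EuclideanSpace.single k (1 : ℝ)))) *
                    fderiv ℝ Ψ.ψ X (Pi.single i (EuclideanSpace.single k (1 : ℝ)))).re) +
                (periodicInteraction v L X).toReal * (starRingEnd ℂ (η X) * Ψ.ψ X).re)) =
            (periodicGroundStateEnergy v (n + 1) L).toReal *
              ∫ X in cellN (n + 1) L, (starRingEnd ℂ (η X) * Ψ.ψ X).re := by
  intro v hv htop hC2 _ n L hL Ψ hmin hfin η hη hper hsymm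
  obtain ⟨Cw, hCw, hW⟩ := exists_periodicInteraction_le hv htop hC2.continuous hL (n + 1)
  exact firstVariation_eq hv.1 hCw hW Ψ hmin hfin hη hper hsymm

end ImuWeakEulerLagrange

end Summit.AtomisticToContinuum.BoseEinsteinCondensation.Theorems

end
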